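import Literature.MathematicalPhysics.QuantumFieldTheory.Balaban1983to89.Node00.HistoryTermDatum214
import Literature.MathematicalPhysics.QuantumFieldTheory.Balaban1983to89.B13Term214WindowDilated

/-!
# BalabanUVNodes ∕ node N22 = NE9 — THE W1 OBJECT ON THE RELATIVE-DISC CENTRED ROAD (RE-TYPING M1′), MODULE J5: THE WINDOW-DILATED MEMBER FAMILY OF A (2.14) TERM-DATUM FAMILY
# UNDER THE UNSCALED-FIELD LAW — base-point freeness through the REAL ratio (hMbase) and «the member `b = 1` of base point `s` IS the datum's display at coupling `s`» (hMagree)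
# of J2 ∕ J3 ∕ J4, BY NAME from dag-n10-c g6's `term214_windowDilated_basePoint` and W1-7's `TermDatum214.TF_apply`

Cell `pub-ymgap`, HUMAN RULING D-0062 (Track A), R134 ACCELERATION re-seat `pub-ymgap-dag-n22-c` (strategy s1), generation 7, file J5.  THEOREMS ONLY (no `def`: the member
family is written at LAMBDA LEVEL — the W1 object lineage `node00-def-W1` is the one declarer of W1 definitions and is stood down event-less, wake-ask DESIGN-INPUT-W1 on the
pub-ymgap bus 11:00Z 2026-08-27; a later `TermDatum214.memberTF` definition wraps these statements by `rfl`).  Imports W1-7 `Node00/HistoryTermDatum214` (`TermDatum214`, `.A`, `.Gam`,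
`.TF`, `TF_apply`, `sigmaList`, `tauList`) and dag-n10-c g6 `B13Term214WindowDilated` (§6 `term214_windowDilated_basePoint`) BY NAME.  `--supports` K3⁶ `SpineGivenEndpointR13SepCoPR`
(stmt-QuantumFields-20509; dag-lead WORDS-142) as a helper.

WHY.  J2 ∕ J3 ∕ J4 (the s1 leaf in the producer's window-dilated member currency) display a member family `mF : ℝ → GenTermFun` with two ALGEBRAIC clauses — hMbase
`mF s₁ k′ Z t ((s₁∕s₀)·b) old φ = mF s₀ k′ Z t b old φ` (real base points, every complex `b`) and hMagree `mF s k′ Z t 1 old φ = (𝔇 k′).TF Z t s old φ` on the window — besides the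
analytic member statements (the producer's).  Both algebraic clauses hold for ONE explicit family built from the datum's own fields as soon as the datum's last-line data obey the
UNSCALED-FIELD LAW of [I] (2.9)–(2.12) («we make the scaling transformation B = g_kB′»): on the real window the characteristic functions, the Wilson remainder (× g_k⁻²) and the older
terms are coupling-free functions READ IN THE UNSCALED FIELD `g_k·B′` — `χ_{k,Y₀}(s, B′) = χᵘ(s·B′)`, `χᶜ_{k,P}(s, B′) = χᶜᵘ(s·B′)`, `𝐕_k(Y, s, B′) = s⁻²·𝒲(Y, s·B′) + 𝒪(Y, s·B′)`
(dag-n10-c's «ONE open point» ∕ lens d9: the dilation covariance of the datum; a LAW SCHEMA on W1-7's opaque `chiY₀ ∕ chicP ∕ 𝒱`, displayed here as hypotheses, stated ONLY at real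
couplings of the window).  The member of base point `s₀` at dilation parameter `b` is then n10-c's window-dilated family at the datum's kernels:
`term214 r (Z∖Z′₀) 𝐃 (core214 (b²·A) (b·Γ) (F214 |P| χᵘ(s₀·) χᶜᵘ(s₀·) 𝐃 (b²·W_{s₀} + O_{s₀}))) 0 0`, `W_{s₀}(Y,B′) := s₀⁻²𝒲(Y, s₀B′)`, `O_{s₀}(Y,B′) := 𝒪(Y, s₀B′)`.

WHAT.  ★ `memberOfDatum_basePoint` (hMbase for this family, LAW-FREE: n10-c `term214_windowDilated_basePoint` at the real ratio `r = s₁∕s₀`, the four covariance identities by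
`smul_smul` and `r²·s₁⁻² = s₀⁻²`) · ★ `memberOfDatum_one_eq_TF` (hMagree under the unscaled-field law: `1² • A = A`, `1 • Γ = Γ`, the law, `TF_apply`) — both in the exact binder shapes of
J2's `hMbase` ∕ `hMagree` for `mF s₀ k′ Z t b old φ := <the member>`.  What is LEFT for the producer at the datum: the analytic member statements hMlast ∕ hMprop ∕ hMcen about THIS family
(= n10-c §4 ∕ §5 ∕ `B13Bound226Centred` at `A := (𝔇 k′).A Z t φ`, `Γ := (𝔇 k′).Gam Z t φ`, `χ := χᵘ(s₀·)`, `W := W_{s₀}`, `O := O_{s₀}` from located primitive inputs — W1-8-style storeys)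
and (P) for the coupling-blind centre.

HONEST FRAMING.  Algebra (two rewrites BY NAME); count-neutral; the unscaled-field law is a HYPOTHESIS schema (an inhabitant = NODE 00's datum of record read from def-B13's kernels with
[I] (2.9)–(2.12)'s scaling, not constructed here); nothing of Bałaban's asserted; N22 NOT discharged; one finite four-torus programme at fixed ε — NOT infinite volume, NOT OS on ℝ⁴, NOT
a mass gap, NOT Clay.  0 `sorry`, 0 `def`, standard axioms.

References (TYPES only): [I] = [Balaban1987RG1] §1 p. 263 (the window), (2.9)–(2.13) pp. 266–268 («B = g_kB′ … the third, linear term in (2.10) vanishes … vanishes at g_k = 0»);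
[II] = [Balaban1988RG2Cluster] (1.41) p. 11, (2.14) p. 15.
-/

noncomputable section

namespace YMDAG.N22.W1

open Set Metric
open Literature.MathematicalPhysics.QuantumFieldTheory.Balaban1983to89
open Literature.MathematicalPhysics.QuantumFieldTheory.Balaban1983to89.B13Term214 (term214 core214 F214)
open Literature.MathematicalPhysics.QuantumFieldTheory.Balaban1983to89.B13Term214WindowDilated (term214_windowDilated_basePoint)
open Literature.MathematicalPhysics.QuantumFieldTheory.Balaban1983to89.TreeLengthTorus (TPt TDom)
open Literature.MathematicalPhysics.QuantumFieldTheory.Balaban1983to89.Node00.Sect2 (domSys domCount CPair)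
open Literature.MathematicalPhysics.QuantumFieldTheory.Balaban1983to89.Node00.W1

variable {c : B13.Consts} {P : Params} {𝔸 : Type*} {M L : ℕ} [NeZero L] (𝔇 : TermData214 c P 𝔸 M L)
  (χu χcu : (k' : ℕ) → (Z : (domSys P M (k' + 1)).Dom) → (t : TermLabel P M k' L) → (((𝔇 k').𝒦 Z t).Λ → ℝ) → ℝ)
  (𝒲 : (k' : ℕ) → (Z : (domSys P M (k' + 1)).Dom) → (t : TermLabel P M k' L) → CPair P 𝔸 →
    TDom P.d (L * domCount P M (k' + 1)) → (((𝔇 k').𝒦 Z t).Λ → ℝ) → ℂ)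
  (𝒪 : (k' : ℕ) → (Z : (domSys P M (k' + 1)).Dom) → (t : TermLabel P M k' L) → OlderTerms P 𝔸 M k' → CPair P 𝔸 →
    TDom P.d (L * domCount P M (k' + 1)) → (((𝔇 k').𝒦 Z t).Λ → ℝ) → ℂ)

open Classical in
/-- **hMbase FOR THE MEMBER FAMILY OF THE DATUM — BASE-POINT FREENESS THROUGH THE REAL RATIO (law-free).**  For the window-dilated member of base point `s₀` at dilation parameter `b`,
`m(s₀, b) := term214 r (Z∖Z′₀) 𝐃 (core214 (b²·A) (b·Γ) (F214 |P| χᵘ(s₀·) χᶜᵘ(s₀·) 𝐃 (fun Y B′ ↦ b²·(s₀⁻²·𝒲(Y, s₀B′)) + 𝒪(Y, s₀B′)))) 0 0` (A, Γ the datum's coupling-blind kernels at the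
configuration; χᵘ, χᶜᵘ, 𝒲, 𝒪 any unscaled-field data), two base points see the same coupling through the REAL ratio: `m(s₁, (s₁∕s₀)·b) = m(s₀, b)` for all `s₀, s₁ ∈ ]0,γ]` and EVERY
complex `b` — dag-n10-c g6 `term214_windowDilated_basePoint` at `r = s₁∕s₀` (its four identities: `χᵘ(s₁B′) = χᵘ(s₀(rB′))` by `smul_smul`, `(rb)²·s₁⁻²𝒲(s₁B′) = b²·s₀⁻²𝒲(s₀(rB′))` by
`r²s₁⁻² = s₀⁻²`, the older terms likewise).  Exactly J2's `hMbase` for `mF s₀ k′ Z t b old φ := m(s₀, b)`.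
[cite: Balaban1987RG1, (2.9)-(2.12) pp.266-267; Balaban1988RG2Cluster, (2.14) p.15] -/
theorem memberOfDatum_basePoint {γ : ℝ} (k' : ℕ) (Z : (domSys P M (k' + 1)).Dom) (t : TermLabel P M k' L) (old : OlderTerms P 𝔸 M k') (φ : CPair P 𝔸) :
    ∀ s₀ ∈ Ioc (0 : ℝ) γ, ∀ s₁ ∈ Ioc (0 : ℝ) γ, ∀ b : ℂ,
      term214 (𝔇 k').r (sigmaList L Z t) (tauList P M k' L t)
          (core214 (fun σ => ((((s₁ / s₀ : ℝ)) : ℂ) * b) ^ 2 • (𝔇 k').A Z t φ σ) (fun σ X => ((((s₁ / s₀ : ℝ)) : ℂ) * b) • (𝔇 k').Gam Z t φ σ X)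
            (F214 t.2.card (fun B => χu k' Z t (s₁ • B)) (fun B => χcu k' Z t (s₁ • B)) t.1
              (fun Y B => ((((s₁ / s₀ : ℝ)) : ℂ) * b) ^ 2 * ((((s₁ : ℝ) : ℂ) ^ 2)⁻¹ * 𝒲 k' Z t φ Y (s₁ • B)) + 𝒪 k' Z t old φ Y (s₁ • B)))) 0 0 =
        term214 (𝔇 k').r (sigmaList L Z t) (tauList P M k' L t)
          (core214 (fun σ => b ^ 2 • (𝔇 k').A Z t φ σ) (fun σ X => b • (𝔇 k').Gam Z t φ σ X)
            (F214 t.2.card (fun B => χu k' Z t (s₀ • B)) (fun B => χcu k' Z t (s₀ • B)) t.1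
              (fun Y B => b ^ 2 * ((((s₀ : ℝ) : ℂ) ^ 2)⁻¹ * 𝒲 k' Z t φ Y (s₀ • B)) + 𝒪 k' Z t old φ Y (s₀ • B)))) 0 0 := by
  intro s₀ hs₀ s₁ hs₁ b
  have h0 : s₀ ≠ 0 := hs₀.1.ne'
  have h1 : s₁ ≠ 0 := hs₁.1.ne'
  have hr : s₁ / s₀ ≠ 0 := div_ne_zero h1 h0
  have hsm : ∀ B : ((𝔇 k').𝒦 Z t).Λ → ℝ, s₀ • ((s₁ / s₀) • B) = s₁ • B := fun B => by
    rw [smul_smul, mul_div_cancel₀ _ h0]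
  refine term214_windowDilated_basePoint (𝔇 k').r (sigmaList L Z t) (tauList P M k' L t) ((𝔇 k').A Z t φ) ((𝔇 k').Gam Z t φ) t.2.card t.1 hr b
    (W₁ := fun Y B => (((s₁ : ℝ) : ℂ) ^ 2)⁻¹ * 𝒲 k' Z t φ Y (s₁ • B)) (W₀ := fun Y B => (((s₀ : ℝ) : ℂ) ^ 2)⁻¹ * 𝒲 k' Z t φ Y (s₀ • B))
    (O₁ := fun Y B => 𝒪 k' Z t old φ Y (s₁ • B)) (O₀ := fun Y B => 𝒪 k' Z t old φ Y (s₀ • B))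
    (fun B => by simp only [hsm]) (fun B => by simp only [hsm]) (fun Y B => ?_) (fun Y B => by simp only [hsm]) 0 0
  -- `(r b)²·s₁⁻²·𝒲(s₁B) = b²·s₀⁻²·𝒲(s₀(rB))`
  simp only [hsm]
  have h0c : ((s₀ : ℝ) : ℂ) ≠ 0 := Complex.ofReal_ne_zero.2 h0
  have h1c : ((s₁ : ℝ) : ℂ) ≠ 0 := Complex.ofReal_ne_zero.2 h1
  rw [Complex.ofReal_div]
  field_simp

open Classical in
/-- **hMagree FOR THE MEMBER FAMILY OF THE DATUM UNDER THE UNSCALED-FIELD LAW.**  If on the real window the datum's last-line data are read in the unscaled field —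
`χ_{k′,Y₀}(s, B′) = χᵘ(s·B′)`, `χᶜ_{k′,P}(s, B′) = χᶜᵘ(s·B′)`, `𝐕_{k′}(Y, s, old, φ, B′) = s⁻²·𝒲(φ, Y, s·B′) + 𝒪(old, φ, Y, s·B′)` (the Wilson remainder is HISTORY-FREE, the older terms enter ONLY through 𝒪 — [I] (2.12)–(2.13) p.268) for `s ∈ ]0,γ]` ([I] (2.9)–(2.12) «B = g_kB′»: thresholds,
the Wilson remainder × g_k⁻², the older terms BY EVALUATION at the unscaled fluctuation) — then the member of base point `s` at `b = 1` IS the datum's (2.14) display at coupling `s`: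
`m(s, 1) = (𝔇 k′).TF Z t s old φ` (`1² • A = A`, `1 • Γ = Γ`, the law, W1-7 `TF_apply`).  Exactly J2's `hMagree` for `mF s₀ k′ Z t b old φ := m(s₀, b)`.
[cite: Balaban1987RG1, §1 p.263 and (2.9)-(2.13) pp.266-268; Balaban1988RG2Cluster, (1.41) p.11 and (2.14) p.15] -/
theorem memberOfDatum_one_eq_TF {γ : ℝ}
    (hlaw : ∀ (k' : ℕ) (Z : (domSys P M (k' + 1)).Dom) (t : TermLabel P M k' L), ∀ s ∈ Ioc (0 : ℝ) γ,
      (∀ B, (𝔇 k').chiY₀ Z t (s : ℂ) B = χu k' Z t (s • B)) ∧ (∀ B, (𝔇 k').chicP Z t (s : ℂ) B = χcu k' Z t (s • B)) ∧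
        ∀ (old : OlderTerms P 𝔸 M k') (φ : CPair P 𝔸) (Y : TDom P.d (L * domCount P M (k' + 1))) (B : ((𝔇 k').𝒦 Z t).Λ → ℝ),
          (𝔇 k').𝒱 Z t (s : ℂ) old φ Y B = (((s : ℝ) : ℂ) ^ 2)⁻¹ * 𝒲 k' Z t φ Y (s • B) + 𝒪 k' Z t old φ Y (s • B))
    (k' : ℕ) (Z : (domSys P M (k' + 1)).Dom) (t : TermLabel P M k' L) (s : ℝ) (hs : s ∈ Ioc (0 : ℝ) γ) (old : OlderTerms P 𝔸 M k') (φ : CPair P 𝔸) :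
    term214 (𝔇 k').r (sigmaList L Z t) (tauList P M k' L t)
        (core214 (fun σ => (1 : ℂ) ^ 2 • (𝔇 k').A Z t φ σ) (fun σ X => (1 : ℂ) • (𝔇 k').Gam Z t φ σ X)
          (F214 t.2.card (fun B => χu k' Z t (s • B)) (fun B => χcu k' Z t (s • B)) t.1
            (fun Y B => (1 : ℂ) ^ 2 * ((((s : ℝ) : ℂ) ^ 2)⁻¹ * 𝒲 k' Z t φ Y (s • B)) + 𝒪 k' Z t old φ Y (s • B)))) 0 0 =
      (𝔇 k').TF Z t (s : ℂ) old φ := by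
  obtain ⟨hχ, hχc, hV⟩ := hlaw k' Z t s hs
  have hA : (fun σ => (1 : ℂ) ^ 2 • (𝔇 k').A Z t φ σ) = (𝔇 k').A Z t φ := funext fun σ => by rw [one_pow, one_smul]
  have hΓ : (fun σ X => (1 : ℂ) • (𝔇 k').Gam Z t φ σ X) = (𝔇 k').Gam Z t φ := funext fun σ => funext fun X => one_smul _ _
  have hF : F214 t.2.card (fun B => χu k' Z t (s • B)) (fun B => χcu k' Z t (s • B)) t.1
        (fun Y B => (1 : ℂ) ^ 2 * ((((s : ℝ) : ℂ) ^ 2)⁻¹ * 𝒲 k' Z t φ Y (s • B)) + 𝒪 k' Z t old φ Y (s • B))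
      = F214 t.2.card ((𝔇 k').chiY₀ Z t (s : ℂ)) ((𝔇 k').chicP Z t (s : ℂ)) t.1 ((𝔇 k').𝒱 Z t (s : ℂ) old φ) := by
    have e1 : (fun B => χu k' Z t (s • B)) = (𝔇 k').chiY₀ Z t (s : ℂ) := funext fun B => (hχ B).symm
    have e2 : (fun B => χcu k' Z t (s • B)) = (𝔇 k').chicP Z t (s : ℂ) := funext fun B => (hχc B).symm
    have e3 : (fun Y B => (1 : ℂ) ^ 2 * ((((s : ℝ) : ℂ) ^ 2)⁻¹ * 𝒲 k' Z t φ Y (s • B)) + 𝒪 k' Z t old φ Y (s • B)) = (𝔇 k').𝒱 Z t (s : ℂ) old φ :=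
      funext fun Y => funext fun B => by rw [one_pow, one_mul, hV old φ Y B]
    rw [e1, e2, e3]
  rw [TermDatum214.TF_apply, hA, hΓ, hF]

end YMDAG.N22.W1

end
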